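import Summits.BirchSwinnertonDyer.BirchSwinnertonDyer.Theorems.EdixhovenFibreFiveSevenStarredOptimalManinUnitFiveSevenHcorPrimePow
import Literature.NumberTheory.Automorphic.UnboundedDenominatorsTwoPow
import Literature.NumberTheory.Automorphic.UnboundedDenominatorsTwoLevelFour
import Literature.NumberTheory.Automorphic.UnboundedDenominatorsTwoCharacter
import HarnessLib

set_option autoImplicit false
-- the sub-problem namespace `Summit.BirchSwinnertonDyer.BirchSwinnertonDyer` duplicates a component by design (D-0017)
set_option linter.dupNamespace false

/-!
# K★ line `cdt_thm1`, stub `stub_hcor_invariant`: the `2`-adic depth step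

Crux `StarredOptimalManinUnitFiveSeven` (stmt-BirchSwinnertonDyer-22226); skeleton v17 has the single stub
`stub_hcor_invariant` (the invariant form of [CalegariDimitrovTang2025, Corollary 4.5.3], all `N`).
`…HcorPrimePow` settled every level with `4 ∤ N`.  This file is the `2`-adic depth step (`two_adic_step`), where
the Schur multiplier of `SL₂(ℤ/2^e)` is a genuine `ℤ/2` ([Beyl1986]): for `N = 2M`, `2 ∣ M`, and an invariant
`θ : Γ(2M) → Q` of `2`-power exponent, the auxiliary invariant character `θ₂ : Γ(2M) → ℤ/2`
(`UnboundedDenominatorsTwoCharacter`) is adjoined, `θ̃ = θ × θ₂`; modulo the value `z₀ = θ̃(ω₀)`,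
`ω₀ = [T^M, S T^M S⁻¹]`, the image of `Γ(M)` is abelian (`UnboundedDenominatorsTwoLayer`), so Step A
(`UnboundedDenominatorsTwoPow`) puts `θ̃(y)`, `y ∈ Γ(2M) ∩ [SL₂(ℤ), Γ(M)]`, in `⟨θ̃[T, h₀], z₀⟩`; both generators
are `2`-torsion, one of them is trivial (`z₀` if `4 ∣ M` by `TwoLayer`, `θ̃[T, h₀]` if `M ≡ 2 (4)` by
`TwoLevelFour`) and the other has `θ₂`-component `1 ∈ ℤ/2` (explicit matrix entries), while `θ₂(y) = 0` for
`y ∈ Γ(4M)`: hence `θ(y) = 1`.  With the induction hypothesis at level `M` (through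
`HcorPrimePow.exists_pow_mem_commutator_of_forall`: `x^k ∈ [SL₂(ℤ), Γ(M)]` for `x ∈ Γ(12M)`, `k` odd) this is the
depth step; the induction itself is in `…HcorTwoPow`.  K★ / Manin / BSD are not proved in this file.
-/

open scoped MatrixGroups commutatorElement

namespace Summit.BirchSwinnertonDyer.BirchSwinnertonDyer.Theorems

namespace HcorTwoAdicStep

open CongruenceSubgroup Matrix.SpecialLinearGroup ModularGroup
open Literature.NumberTheory.Automorphic.UnboundedDenominators

/-- `Γ(L) ≤ Γ(M)` for `M ∣ L`. [folklore] -/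
private theorem Gamma_le_Gamma_of_dvd₁₆ {M L : ℕ} (h : M ∣ L) : Gamma L ≤ Gamma M := by
  intro γ hγ
  obtain ⟨h00, h01, h10, h11⟩ := Gamma_mem.mp hγ
  have cast_eq : ∀ a : ℤ, ((a : ZMod L).cast : ZMod M) = (a : ZMod M) := fun a ↦
    ZMod.cast_intCast h a
  rw [Gamma_mem]
  refine ⟨?_, ?_, ?_, ?_⟩
  · rw [← cast_eq, h00, ZMod.cast_one h]
  · rw [← cast_eq, h01, ZMod.cast_zero]
  · rw [← cast_eq, h10, ZMod.cast_zero]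
  · rw [← cast_eq, h11, ZMod.cast_one h]

/-- `T^M ∈ Γ(M)`. [folklore] -/
private theorem T_pow_mem_Gamma₆ (M : ℕ) : T ^ M ∈ Gamma M := by
  have := ModularGroup_T_pow_mem_Gamma (M : ℤ) (M : ℤ) (dvd_refl _)
  rwa [zpow_natCast, Int.natAbs_natCast] at this

/-- The integer matrix of `T^M`. [folklore] -/
private theorem coe_T_pow₆ (M : ℕ) : ((T ^ M : SL(2, ℤ)) : Matrix (Fin 2) (Fin 2) ℤ) = !![1, (M : ℤ); 0, 1] := by
  rw [show (T ^ M : SL(2, ℤ)) = T ^ (M : ℤ) from (zpow_natCast T M).symm]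
  exact coe_T_zpow (M : ℤ)

/-- The integer matrix of `S⁻¹`. [folklore] -/
private theorem coe_S_inv₆ : ((S⁻¹ : SL(2, ℤ)) : Matrix (Fin 2) (Fin 2) ℤ) = !![0, 1; -1, 0] := by
  simp [Matrix.SpecialLinearGroup.coe_inv, coe_S, Matrix.adjugate_fin_two]

/-- `S T^M S⁻¹ = [[1, 0], [-M, 1]]`. [folklore] -/
private theorem coe_F₆ (M : ℕ) :
    ((S * T ^ M * S⁻¹ : SL(2, ℤ)) : Matrix (Fin 2) (Fin 2) ℤ) = !![1, 0; -(M : ℤ), 1] := by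
  rw [Matrix.SpecialLinearGroup.coe_mul, Matrix.SpecialLinearGroup.coe_mul, coe_S_inv₆, coe_S, coe_T_pow₆]
  ext i j
  fin_cases i <;> fin_cases j <;> simp [Matrix.mul_apply, Fin.sum_univ_two]

/-- `T (S T^M S⁻¹) T⁻¹ = [[1-M, M], [-M, 1+M]]`. [folklore] -/
private theorem coe_U₆ (M : ℕ) :
    ((T * (S * T ^ M * S⁻¹) * T⁻¹ : SL(2, ℤ)) : Matrix (Fin 2) (Fin 2) ℤ) =
      !![1 - (M : ℤ), (M : ℤ); -(M : ℤ), 1 + (M : ℤ)] := by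
  rw [Matrix.SpecialLinearGroup.coe_mul, Matrix.SpecialLinearGroup.coe_mul, coe_F₆, coe_T, coe_T_inv]
  ext i j
  fin_cases i <;> fin_cases j <;> simp [Matrix.mul_apply, Fin.sum_univ_two] <;> ring

/-- The lift `h₀ = T^M (S T^M S⁻¹) (T (S T^M S⁻¹) T⁻¹)⁻¹` of `H`: its integer matrix. [folklore] -/
private theorem coe_h0₆ (M : ℕ) :
    ((T ^ M * (S * T ^ M * S⁻¹) * (T * (S * T ^ M * S⁻¹) * T⁻¹)⁻¹ : SL(2, ℤ)) : Matrix (Fin 2) (Fin 2) ℤ) =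
      !![1 + (M : ℤ) - (M : ℤ) ^ 3, (M : ℤ) ^ 3 - (M : ℤ) ^ 2; -(M : ℤ) ^ 2, 1 - (M : ℤ) + (M : ℤ) ^ 2] := by
  rw [Matrix.SpecialLinearGroup.coe_mul, Matrix.SpecialLinearGroup.coe_mul, Matrix.SpecialLinearGroup.coe_inv,
    coe_U₆, coe_F₆, coe_T_pow₆, Matrix.adjugate_fin_two]
  ext i j
  fin_cases i <;> fin_cases j <;> simp [Matrix.mul_apply, Fin.sum_univ_two] <;> ring

/-- The entries of `[T, h₀]`. [folklore] -/
private theorem c_entries₆ (M : ℕ) :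
    ((⁅T, T ^ M * (S * T ^ M * S⁻¹) * (T * (S * T ^ M * S⁻¹) * T⁻¹)⁻¹⁆ : SL(2, ℤ)) 0 0 : ℤ) =
        1 - (M : ℤ) ^ 2 - (M : ℤ) ^ 3 + (M : ℤ) ^ 4 + (M : ℤ) ^ 5 ∧
      ((⁅T, T ^ M * (S * T ^ M * S⁻¹) * (T * (S * T ^ M * S⁻¹) * T⁻¹)⁻¹⁆ : SL(2, ℤ)) 0 1 : ℤ) =
        -2 * (M : ℤ) + 3 * (M : ℤ) ^ 3 + 2 * (M : ℤ) ^ 4 - (M : ℤ) ^ 5 - (M : ℤ) ^ 6 ∧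
      ((⁅T, T ^ M * (S * T ^ M * S⁻¹) * (T * (S * T ^ M * S⁻¹) * T⁻¹)⁻¹⁆ : SL(2, ℤ)) 1 0 : ℤ) = (M : ℤ) ^ 4 := by
  have h : ((⁅T, T ^ M * (S * T ^ M * S⁻¹) * (T * (S * T ^ M * S⁻¹) * T⁻¹)⁻¹⁆ : SL(2, ℤ)) : Matrix (Fin 2) (Fin 2) ℤ) =
      (T : Matrix (Fin 2) (Fin 2) ℤ) * !![1 + (M : ℤ) - (M : ℤ) ^ 3, (M : ℤ) ^ 3 - (M : ℤ) ^ 2; -(M : ℤ) ^ 2, 1 - (M : ℤ) + (M : ℤ) ^ 2] *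
        ((T⁻¹ : SL(2, ℤ)) : Matrix (Fin 2) (Fin 2) ℤ) *
        Matrix.adjugate !![1 + (M : ℤ) - (M : ℤ) ^ 3, (M : ℤ) ^ 3 - (M : ℤ) ^ 2; -(M : ℤ) ^ 2, 1 - (M : ℤ) + (M : ℤ) ^ 2] := by
    rw [commutatorElement_def, Matrix.SpecialLinearGroup.coe_mul, Matrix.SpecialLinearGroup.coe_mul,
      Matrix.SpecialLinearGroup.coe_mul, Matrix.SpecialLinearGroup.coe_inv (T ^ M * _ * _), coe_h0₆]
  refine ⟨?_, ?_, ?_⟩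
  · rw [show ((⁅T, T ^ M * (S * T ^ M * S⁻¹) * (T * (S * T ^ M * S⁻¹) * T⁻¹)⁻¹⁆ : SL(2, ℤ)) 0 0 : ℤ) =
        ((⁅T, T ^ M * (S * T ^ M * S⁻¹) * (T * (S * T ^ M * S⁻¹) * T⁻¹)⁻¹⁆ : SL(2, ℤ)) : Matrix (Fin 2) (Fin 2) ℤ) 0 0
        from rfl, h, coe_T, coe_T_inv, Matrix.adjugate_fin_two]
    simp [Matrix.mul_apply, Fin.sum_univ_two]; ring
  · rw [show ((⁅T, T ^ M * (S * T ^ M * S⁻¹) * (T * (S * T ^ M * S⁻¹) * T⁻¹)⁻¹⁆ : SL(2, ℤ)) 0 1 : ℤ) =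
        ((⁅T, T ^ M * (S * T ^ M * S⁻¹) * (T * (S * T ^ M * S⁻¹) * T⁻¹)⁻¹⁆ : SL(2, ℤ)) : Matrix (Fin 2) (Fin 2) ℤ) 0 1
        from rfl, h, coe_T, coe_T_inv, Matrix.adjugate_fin_two]
    simp [Matrix.mul_apply, Fin.sum_univ_two]; ring
  · rw [show ((⁅T, T ^ M * (S * T ^ M * S⁻¹) * (T * (S * T ^ M * S⁻¹) * T⁻¹)⁻¹⁆ : SL(2, ℤ)) 1 0 : ℤ) =
        ((⁅T, T ^ M * (S * T ^ M * S⁻¹) * (T * (S * T ^ M * S⁻¹) * T⁻¹)⁻¹⁆ : SL(2, ℤ)) : Matrix (Fin 2) (Fin 2) ℤ) 1 0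
        from rfl, h, coe_T, coe_T_inv, Matrix.adjugate_fin_two]
    simp [Matrix.mul_apply, Fin.sum_univ_two]; ring

/-- The entries of `ω₀ = [T^M, S T^M S⁻¹]`. [folklore] -/
private theorem omega_entries₆ (M : ℕ) :
    ((⁅T ^ M, S * T ^ M * S⁻¹⁆ : SL(2, ℤ)) 0 0 : ℤ) = 1 - (M : ℤ) ^ 2 + (M : ℤ) ^ 4 ∧
      ((⁅T ^ M, S * T ^ M * S⁻¹⁆ : SL(2, ℤ)) 0 1 : ℤ) = (M : ℤ) ^ 3 ∧
      ((⁅T ^ M, S * T ^ M * S⁻¹⁆ : SL(2, ℤ)) 1 0 : ℤ) = (M : ℤ) ^ 3 := by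
  have h : ((⁅T ^ M, S * T ^ M * S⁻¹⁆ : SL(2, ℤ)) : Matrix (Fin 2) (Fin 2) ℤ) =
      !![1, (M : ℤ); 0, 1] * !![1, 0; -(M : ℤ), 1] * Matrix.adjugate !![1, (M : ℤ); 0, 1] *
        Matrix.adjugate !![1, 0; -(M : ℤ), 1] := by
    rw [commutatorElement_def, Matrix.SpecialLinearGroup.coe_mul, Matrix.SpecialLinearGroup.coe_mul,
      Matrix.SpecialLinearGroup.coe_mul, Matrix.SpecialLinearGroup.coe_inv, Matrix.SpecialLinearGroup.coe_inv,
      coe_F₆, coe_T_pow₆]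
  refine ⟨?_, ?_, ?_⟩
  · rw [show ((⁅T ^ M, S * T ^ M * S⁻¹⁆ : SL(2, ℤ)) 0 0 : ℤ) =
        ((⁅T ^ M, S * T ^ M * S⁻¹⁆ : SL(2, ℤ)) : Matrix (Fin 2) (Fin 2) ℤ) 0 0 from rfl, h,
      Matrix.adjugate_fin_two, Matrix.adjugate_fin_two]
    simp [Matrix.mul_apply, Fin.sum_univ_two]; ring
  · rw [show ((⁅T ^ M, S * T ^ M * S⁻¹⁆ : SL(2, ℤ)) 0 1 : ℤ) =
        ((⁅T ^ M, S * T ^ M * S⁻¹⁆ : SL(2, ℤ)) : Matrix (Fin 2) (Fin 2) ℤ) 0 1 from rfl, h,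
      Matrix.adjugate_fin_two, Matrix.adjugate_fin_two]
    simp [Matrix.mul_apply, Fin.sum_univ_two]; ring
  · rw [show ((⁅T ^ M, S * T ^ M * S⁻¹⁆ : SL(2, ℤ)) 1 0 : ℤ) =
        ((⁅T ^ M, S * T ^ M * S⁻¹⁆ : SL(2, ℤ)) : Matrix (Fin 2) (Fin 2) ℤ) 1 0 from rfl, h,
      Matrix.adjugate_fin_two, Matrix.adjugate_fin_two]
    simp [Matrix.mul_apply, Fin.sum_univ_two]; ring

/-- `S S h₀`: its integer matrix is `-h₀`. [folklore] -/
private theorem coe_SSh0₆ (M : ℕ) :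
    ((S * S * (T ^ M * (S * T ^ M * S⁻¹) * (T * (S * T ^ M * S⁻¹) * T⁻¹)⁻¹) : SL(2, ℤ)) : Matrix (Fin 2) (Fin 2) ℤ) =
      !![-(1 + (M : ℤ) - (M : ℤ) ^ 3), -((M : ℤ) ^ 3 - (M : ℤ) ^ 2); (M : ℤ) ^ 2, -(1 - (M : ℤ) + (M : ℤ) ^ 2)] := by
  rw [Matrix.SpecialLinearGroup.coe_mul, coe_h0₆, Matrix.SpecialLinearGroup.coe_mul, coe_S]
  ext i j
  fin_cases i <;> fin_cases j <;> simp [Matrix.mul_apply, Fin.sum_univ_two]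

/-- Parity bookkeeping in `Q × ℤ/2`. [folklore] -/
private theorem zpow_eq_one_of_snd₆ {Q : Type*} [CommGroup Q] (u : Q × Multiplicative (ZMod 2)) (hu2 : u ^ 2 = 1)
    (hu : u.2 = Multiplicative.ofAdd 1) (n : ℤ) (h : (u ^ n).2 = 1) : u ^ n = 1 := by
  rcases Int.even_or_odd n with ⟨c, hc⟩ | ⟨c, hc⟩
  · rw [hc, ← two_mul, zpow_mul, zpow_ofNat, hu2, one_zpow]
  · exfalso
    rw [hc, zpow_add, zpow_mul, zpow_ofNat, hu2, one_zpow, one_mul, zpow_one, hu] at h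
    rw [← ofAdd_zero] at h
    exact absurd (Multiplicative.ofAdd.injective h) (by decide)

/-- The entries of `S S h₀ = -h₀`. [folklore] -/
private theorem SSh0_entries₆ (M : ℕ) :
    ((S * S * (T ^ M * (S * T ^ M * S⁻¹) * (T * (S * T ^ M * S⁻¹) * T⁻¹)⁻¹) : SL(2, ℤ)) 0 0 : ℤ) = -(1 + (M : ℤ) - (M : ℤ) ^ 3) ∧
      ((S * S * (T ^ M * (S * T ^ M * S⁻¹) * (T * (S * T ^ M * S⁻¹) * T⁻¹)⁻¹) : SL(2, ℤ)) 0 1 : ℤ) = -((M : ℤ) ^ 3 - (M : ℤ) ^ 2) ∧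
      ((S * S * (T ^ M * (S * T ^ M * S⁻¹) * (T * (S * T ^ M * S⁻¹) * T⁻¹)⁻¹) : SL(2, ℤ)) 1 0 : ℤ) = (M : ℤ) ^ 2 ∧
      ((S * S * (T ^ M * (S * T ^ M * S⁻¹) * (T * (S * T ^ M * S⁻¹) * T⁻¹)⁻¹) : SL(2, ℤ)) 1 1 : ℤ) = -(1 - (M : ℤ) + (M : ℤ) ^ 2) := by
  refine ⟨?_, ?_, ?_, ?_⟩
  · rw [show ((S * S * (T ^ M * (S * T ^ M * S⁻¹) * (T * (S * T ^ M * S⁻¹) * T⁻¹)⁻¹) : SL(2, ℤ)) 0 0 : ℤ) = ((S * S * (T ^ M * (S * T ^ M * S⁻¹) * (T * (S * T ^ M * S⁻¹) * T⁻¹)⁻¹) : SL(2, ℤ)) : Matrix (Fin 2) (Fin 2) ℤ) 0 0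
      from rfl, coe_SSh0₆]; simp
  · rw [show ((S * S * (T ^ M * (S * T ^ M * S⁻¹) * (T * (S * T ^ M * S⁻¹) * T⁻¹)⁻¹) : SL(2, ℤ)) 0 1 : ℤ) = ((S * S * (T ^ M * (S * T ^ M * S⁻¹) * (T * (S * T ^ M * S⁻¹) * T⁻¹)⁻¹) : SL(2, ℤ)) : Matrix (Fin 2) (Fin 2) ℤ) 0 1
      from rfl, coe_SSh0₆]; simp
  · rw [show ((S * S * (T ^ M * (S * T ^ M * S⁻¹) * (T * (S * T ^ M * S⁻¹) * T⁻¹)⁻¹) : SL(2, ℤ)) 1 0 : ℤ) = ((S * S * (T ^ M * (S * T ^ M * S⁻¹) * (T * (S * T ^ M * S⁻¹) * T⁻¹)⁻¹) : SL(2, ℤ)) : Matrix (Fin 2) (Fin 2) ℤ) 1 0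
      from rfl, coe_SSh0₆]; simp
  · rw [show ((S * S * (T ^ M * (S * T ^ M * S⁻¹) * (T * (S * T ^ M * S⁻¹) * T⁻¹)⁻¹) : SL(2, ℤ)) 1 1 : ℤ) = ((S * S * (T ^ M * (S * T ^ M * S⁻¹) * (T * (S * T ^ M * S⁻¹) * T⁻¹)⁻¹) : SL(2, ℤ)) : Matrix (Fin 2) (Fin 2) ℤ) 1 1
      from rfl, coe_SSh0₆]; simp

/-- `UnboundedDenominatorsTwoLevelFour` with the level as a variable. [cite: CalegariDimitrovTang2025, Corollary 4.5.3] -/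
private theorem level_four₆ {Q : Type*} [CommGroup Q] {N m a : ℕ} (hN : N = 4 * m) (hm : Odd m)
    (θ : Gamma N →* Q)
    (hθ : ∀ (g x : SL(2, ℤ)) (hx : x ∈ Gamma N) (hgx : g * x * g⁻¹ ∈ Gamma N),
      θ ⟨g * x * g⁻¹, hgx⟩ = θ ⟨x, hx⟩)
    (he : ∀ x : Gamma N, θ x ^ (2 ^ a) = 1) {h : SL(2, ℤ)} (hh : h ∈ Gamma (2 * m))
    (hh4 : S * S * h ∈ Gamma 4) (hgh : ⁅T, h⁆ ∈ Gamma N) : θ ⟨⁅T, h⁆, hgh⟩ = 1 := by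
  subst hN
  exact map_commutator_eq_one_of_neg_one_mod_four hm θ hθ he hh hh4 T (Or.inl rfl) hgh

/-- **The `2`-adic depth step.**  Let `M ≠ 0`, `2 ∣ M`, and assume the invariant form at level `M` for all
targets of `2`-power exponent (conclusion on `Γ(12M)`).  Then every `SL₂(ℤ)`-conjugation-invariant
`θ : Γ(2M) → Q`, `Q` finite commutative of `2`-power exponent, is trivial on `Γ(12·2M)`.
[cite: CalegariDimitrovTang2025, Corollary 4.5.3] [cite: Beyl1986, Theorem] -/
theorem two_adic_step {M : ℕ} (hM0 : M ≠ 0) (hM2 : 2 ∣ M)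
    (hIH : ∀ (Q' : Type) [CommGroup Q'] [Finite Q'] (a' : ℕ), (∀ q : Q', q ^ (2 ^ a') = 1) →
      ∀ (ψ : Gamma M →* Q'),
      (∀ (g x : SL(2, ℤ)) (hx : x ∈ Gamma M) (hgx : g * x * g⁻¹ ∈ Gamma M),
        ψ ⟨g * x * g⁻¹, hgx⟩ = ψ ⟨x, hx⟩) →
      ∀ (x : SL(2, ℤ)) (hx : x ∈ Gamma M), x ∈ Gamma (12 * M) → ψ ⟨x, hx⟩ = 1)
    (Q : Type) [CommGroup Q] [Finite Q] (a : ℕ) (hQ : ∀ q : Q, q ^ (2 ^ a) = 1)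
    (θ : Gamma (M * 2) →* Q)
    (hθ : ∀ (g x : SL(2, ℤ)) (hx : x ∈ Gamma (M * 2)) (hgx : g * x * g⁻¹ ∈ Gamma (M * 2)),
      θ ⟨g * x * g⁻¹, hgx⟩ = θ ⟨x, hx⟩) :
    ∀ (x : SL(2, ℤ)) (hx : x ∈ Gamma (M * 2)), x ∈ Gamma (12 * (M * 2)) → θ ⟨x, hx⟩ = 1 := by
  classical
  haveI := Gamma_normal (M * 2)
  haveI := Gamma_normal M
  have hN0 : M * 2 ≠ 0 := Nat.mul_ne_zero hM0 two_ne_zero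
  have h20 : (2 : ZMod 2) = 0 := by decide
  obtain ⟨k, hk2, hk⟩ := HcorPrimePow.exists_pow_mem_commutator_of_forall Nat.prime_two hM0 hIH
  -- the auxiliary character `θ₂` and `θ̃ = θ × θ₂`
  obtain ⟨θ₂, h₂inv, h₂ker, h₂val⟩ := exists_invariant_twoChar hN0 (dvd_mul_left 2 M)
  set θt : Gamma (M * 2) →* Q × Multiplicative (ZMod 2) := θ.prod θ₂ with hθt
  have htval : ∀ y : Gamma (M * 2), θt y = (θ y, θ₂ y) := fun y ↦ rfl
  have htinv : ∀ (g x : SL(2, ℤ)) (hx : x ∈ Gamma (M * 2)) (hgx : g * x * g⁻¹ ∈ Gamma (M * 2)),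
      θt ⟨g * x * g⁻¹, hgx⟩ = θt ⟨x, hx⟩ := by
    intro g x hx hgx
    rw [htval, htval, hθ g x hx hgx, h₂inv g x hx hgx]
  have h2t : ∀ t : Multiplicative (ZMod 2), t ^ 2 = 1 := by decide
  have hte : ∀ y : Gamma (M * 2), θt y ^ (2 ^ (a + 1)) = 1 := by
    intro y
    rw [htval, Prod.pow_mk, Prod.mk_eq_one]
    constructor
    · rw [pow_succ, pow_mul, hQ, one_pow]
    · rw [pow_succ', pow_mul, h2t, one_pow]
  -- squares of commutator values `θ̃[e, f]`, `f ∈ Γ(M)`, vanish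
  have hsq : ∀ (e f : SL(2, ℤ)) (hf : f ∈ Gamma M) (hef : ⁅e, f⁆ ∈ Gamma (M * 2)),
      θt ⟨⁅e, f⁆, hef⟩ ^ 2 = 1 := by
    intro e f hf hef
    have hf2 : f * f ∈ Gamma (M * 2) := by
      have h := pow_mem_Gamma_mul_of_dvd hM2 hf
      rwa [pow_two] at h
    have h2 : ⁅e, f * f⁆ = ⁅e, f⁆ * (f * ⁅e, f⁆ * f⁻¹) := by simp only [commutatorElement_def]; group
    have hffc : f * ⁅e, f⁆ * f⁻¹ ∈ Gamma (M * 2) := (Gamma_normal _).conj_mem _ hef f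
    have hef2 : ⁅e, f * f⁆ ∈ Gamma (M * 2) := by rw [h2]; exact mul_mem hef hffc
    have e2 : θt ⟨⁅e, f * f⁆, hef2⟩ = θt ⟨⁅e, f⁆, hef⟩ * θt ⟨⁅e, f⁆, hef⟩ := by
      have h3 : (⟨⁅e, f * f⁆, hef2⟩ : Gamma (M * 2)) = ⟨⁅e, f⁆, hef⟩ * ⟨f * ⁅e, f⁆ * f⁻¹, hffc⟩ :=
        Subtype.ext h2
      rw [h3, map_mul, htinv f _ hef hffc]
    have e3 : θt ⟨⁅e, f * f⁆, hef2⟩ = 1 := by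
      have hc1 : e * (f * f) * e⁻¹ ∈ Gamma (M * 2) := (Gamma_normal _).conj_mem _ hf2 e
      have h3 : (⟨⁅e, f * f⁆, hef2⟩ : Gamma (M * 2)) = ⟨e * (f * f) * e⁻¹, hc1⟩ * ⟨f * f, hf2⟩⁻¹ :=
        Subtype.ext (commutatorElement_def e (f * f))
      rw [h3, map_mul, map_inv, htinv e _ hf2 hc1, mul_inv_cancel]
    rw [pow_two, ← e2, e3]
  -- the generators and `ω₀`, `h₀`
  have mE : T ^ M ∈ Gamma M := T_pow_mem_Gamma₆ M
  have mF : S * T ^ M * S⁻¹ ∈ Gamma M := (Gamma_normal M).conj_mem _ mE S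
  have mU : T * (S * T ^ M * S⁻¹) * T⁻¹ ∈ Gamma M := (Gamma_normal M).conj_mem _ mF T
  have mh₀ : T ^ M * (S * T ^ M * S⁻¹) * (T * (S * T ^ M * S⁻¹) * T⁻¹)⁻¹ ∈ Gamma M :=
    mul_mem (mul_mem mE mF) (inv_mem mU)
  have hω₀ : ⁅T ^ M, S * T ^ M * S⁻¹⁆ ∈ Gamma (M * 2) := commutatorElement_mem_Gamma_two_mul hM2 mE mF
  set z₀ : Q × Multiplicative (ZMod 2) := θt ⟨⁅T ^ M, S * T ^ M * S⁻¹⁆, hω₀⟩ with hz₀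
  -- the quotient by `z₀`: there the image of `Γ(M)` is abelian and Step A applies
  set C : Subgroup (Q × Multiplicative (ZMod 2)) := Subgroup.zpowers z₀ with hC
  set θq : Gamma (M * 2) →* (Q × Multiplicative (ZMod 2)) ⧸ C := (QuotientGroup.mk' C).comp θt with hθq
  have hqval : ∀ y : Gamma (M * 2), θq y = QuotientGroup.mk' C (θt y) := fun y ↦ rfl
  have hqinv : ∀ (g x : SL(2, ℤ)) (hx : x ∈ Gamma (M * 2)) (hgx : g * x * g⁻¹ ∈ Gamma (M * 2)),
      θq ⟨g * x * g⁻¹, hgx⟩ = θq ⟨x, hx⟩ := by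
    intro g x hx hgx
    rw [hqval, hqval, htinv g x hx hgx]
  have hqω : θq ⟨⁅T ^ M, S * T ^ M * S⁻¹⁆, hω₀⟩ = 1 := by
    rw [hqval, ← hz₀, QuotientGroup.mk'_apply, QuotientGroup.eq_one_iff]
    exact Subgroup.mem_zpowers z₀
  have hab : ∀ (x y : SL(2, ℤ)) (hx : x ∈ Gamma M) (hy : y ∈ Gamma M) (hxy : ⁅x, y⁆ ∈ Gamma (M * 2)),
      θq ⟨⁅x, y⁆, hxy⟩ = 1 :=
    fun x y hx hy hxy ↦ map_commutatorElement_top_eq_one_of_two hM0 hM2 θq hqinv hqω hx hy hxy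
  obtain ⟨hc, -, hA⟩ := exists_zpow_of_mem_commutator_two_layer hM0 hM2 θq hqinv hab
  -- KEY: `θ` kills `Γ(2M) ∩ [SL₂(ℤ), Γ(M)] ∩ Γ(4M)`
  have key : ∀ (y : SL(2, ℤ)) (hy : y ∈ Gamma (M * 2)), y ∈ ⁅(⊤ : Subgroup SL(2, ℤ)), Gamma M⁆ →
      y ∈ Gamma (M * 2 * 2) → θ ⟨y, hy⟩ = 1 := by
    intro y hy hyc hy4
    obtain ⟨i, hi⟩ := hA y hy (Subgroup.mem_sup_left hyc)
    rw [hqval, hqval, ← map_zpow, QuotientGroup.mk'_apply, QuotientGroup.mk'_apply, QuotientGroup.eq] at hi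
    obtain ⟨j, hj⟩ := Subgroup.mem_zpowers_iff.mp hi
    have hy2 : θ₂ ⟨y, hy⟩ = 1 := h₂ker y hy hy4
    have hty : θt ⟨y, hy⟩ = θt ⟨⁅T, T ^ M * (S * T ^ M * S⁻¹) * (T * (S * T ^ M * S⁻¹) * T⁻¹)⁻¹⁆, hc⟩ ^ i * z₀ ^ (-j) := by
      rw [zpow_neg, hj, eq_mul_inv_iff_mul_eq, mul_inv_cancel_left]
    suffices h : θt ⟨y, hy⟩ = 1 by
      have h1 := congrArg Prod.fst h
      rw [htval] at h1
      exact h1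
    by_cases h4 : 4 ∣ M
    · -- `4 ∣ M`: `z₀ = 1` (TwoLayer) and `θ₂[T, h₀] = 1 ∈ ℤ/2`
      have hz1 : z₀ = 1 := map_omega_eq_one_of_four_dvd h4 θt htinv hω₀
      rw [hz1, one_zpow, mul_one] at hty
      obtain ⟨t, ht⟩ := h4
      obtain ⟨c00, c01, c10⟩ := c_entries₆ M
      have hc2 : (θt ⟨⁅T, T ^ M * (S * T ^ M * S⁻¹) * (T * (S * T ^ M * S⁻¹) * T⁻¹)⁻¹⁆, hc⟩).2 = Multiplicative.ofAdd 1 := by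
        rw [htval]
        dsimp only
        rw [h₂val _ hc (-2 * t - 8 * t ^ 2 + 32 * t ^ 3 + 128 * t ^ 4)
          (-1 + 24 * t ^ 2 + 64 * t ^ 3 - 128 * t ^ 4 - 512 * t ^ 5) (32 * t ^ 3)
          (by rw [c00, ht]; push_cast; ring) (by rw [c01, ht]; push_cast; ring) (by rw [c10, ht]; push_cast; ring)]
        congr 1
        push_cast
        linear_combination
          (-1 - (t : ZMod 2) + 8 * (t : ZMod 2) ^ 2 + 64 * (t : ZMod 2) ^ 3 - 256 * (t : ZMod 2) ^ 5) * h20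
      rw [hty]
      exact zpow_eq_one_of_snd₆ _ (hsq T _ mh₀ hc) hc2 i (by rw [← hty, htval]; exact hy2)
    · -- `M ≡ 2 (4)`: `θ̃[T, h₀] = 1` (TwoLevelFour) and `θ₂(ω₀) = 1 ∈ ℤ/2`
      obtain ⟨m, hm⟩ := hM2
      have hmo : Odd m := by
        rcases Nat.even_or_odd m with ⟨r, hr⟩ | ho
        · exact absurd ⟨r, by rw [hm, hr]; ring⟩ h4
        · exact ho
      have hc1 : θt ⟨⁅T, T ^ M * (S * T ^ M * S⁻¹) * (T * (S * T ^ M * S⁻¹) * T⁻¹)⁻¹⁆, hc⟩ = 1 := by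
        refine level_four₆ (show M * 2 = 4 * m by rw [hm]; ring) hmo θt htinv hte (by rw [← hm]; exact mh₀) ?_ hc
        obtain ⟨r, hr⟩ := hmo
        have h40 : (4 : ZMod 4) = 0 := by decide
        have hM4 : (M : ZMod 4) = 2 := by
          rw [hm, hr]; push_cast
          linear_combination (r : ZMod 4) * h40
        obtain ⟨e00, e01, e10, e11⟩ := SSh0_entries₆ M
        rw [Gamma_mem, e00, e01, e10, e11]
        push_cast
        rw [hM4]
        decide
      rw [hc1, one_zpow, one_mul] at hty
      have hz2 : z₀.2 = Multiplicative.ofAdd 1 := by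
        obtain ⟨o00, o01, o10⟩ := omega_entries₆ M
        rw [hz₀, htval]
        dsimp only
        rw [h₂val _ hω₀ (-(m : ℤ) + 4 * m ^ 3) (2 * m ^ 2) (2 * m ^ 2) (by rw [o00, hm]; push_cast; ring)
          (by rw [o01, hm]; push_cast; ring) (by rw [o10, hm]; push_cast; ring)]
        congr 1
        obtain ⟨r, hr⟩ := hmo
        rw [hr]
        push_cast
        linear_combination
          (-(r : ZMod 2) - 1 + 2 * (2 * (r : ZMod 2) + 1) ^ 3 + 2 * (2 * (r : ZMod 2) + 1) ^ 2) * h20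
      rw [hty]
      exact zpow_eq_one_of_snd₆ z₀ (hsq _ _ mF hω₀) hz2 (-j) (by rw [← hty, htval]; exact hy2)
  -- conclusion: `θ(x)^k = 1` with `k` odd
  intro x hx hx12
  have hx12M : x ∈ Gamma (12 * M) := Gamma_le_Gamma_of_dvd₁₆ ⟨2, by ring⟩ hx12
  have hxk : x ^ k ∈ ⁅(⊤ : Subgroup SL(2, ℤ)), Gamma M⁆ := hk x hx12M
  have hx4 : x ^ k ∈ Gamma (M * 2 * 2) := pow_mem (Gamma_le_Gamma_of_dvd₁₆ ⟨6, by ring⟩ hx12) k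
  have h1 : θ ⟨x ^ k, pow_mem hx k⟩ = 1 := key (x ^ k) (pow_mem hx k) hxk hx4
  have h2 : θ ⟨x, hx⟩ ^ k = 1 := by
    rw [← map_pow]; exact h1
  have hcop : Nat.Coprime k (2 ^ a) :=
    (Nat.Coprime.pow_left a ((Nat.Prime.coprime_iff_not_dvd Nat.prime_two).mpr hk2)).symm
  have h := pow_gcd_eq_one.mpr ⟨h2, hQ _⟩
  rwa [Nat.Coprime.gcd_eq_one hcop, pow_one] at h

end HcorTwoAdicStep

end Summit.BirchSwinnertonDyer.BirchSwinnertonDyer.Theorems
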